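import Literature.IUT.HodgeTheaters.BadLocalFrobenioidClaimsIndependence
import HarnessLib

/-!
# [IUTchI] Example 3.2: `BiratFromF`, `ThetaFromF`, `DFromF`, `BasesFromC` are NOT consequences of the
# interface `BadLocalFrobenioid` (the halving counter-model)

Mochizuki, *Inter-universal Teichmüller theory I*, §3, Example 3.2 (ii), (vi) (c), (d), (e), kurims
May-2020 manuscript pp. 69–73 [claim: Mochizuki2012, status: disputed].
abc-iut cell, WAVE-4 (D-0067) cone-interior seat abc-iut-w4-d047; DAG nodes `IUTchI:Ex3.2(i)`–`(vi)`;
completes `BadLocalFrobenioidClaimsIndependence.lean` (counter-model `doubling`: `CFromF`, `DdashFromD`,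
`DThetaFromD`, `FthetaFromF`, `FdashFromC` fail) and `BadLocalFrobenioidClaimsWitness.lean` (all ten
clauses hold on `trivial`).

* `BadLocalFrobenioid.halving l K_v`: every carrier `W = ℤ ∪ {⊤}`; the STRUCTURE functors `F̲_v → D_v`,
  `F̲_v → F÷_v`, `C⊢_v → D⊢_v`, `C^Θ_v → D^Θ_v`, `C^Θ_v ⊆ F÷_v` are the surjection `⌈·/2⌉` (the
  Frobenius-trivial object over `A` is `2A`). The shift `n ↦ n + 1` of the source does not DESCEND along
  `⌈·/2⌉` (`⌈1/2⌉ = 1 ≠ 0 = ⌈0/2⌉` would both have to be the image of `0`), so `BiratFromF` (ii),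
  `ThetaFromF` (ii), `DFromF` (vi)(d), `BasesFromC` (vi)(c) and (again) `FthetaFromF` (vi)(e) FAIL.
* `BadLocalFrobenioidOrbitIndependence.lean` (sibling, no dependency on this file) treats the last clause,
  `OrbitActsOnFtheta` (Rmk. 3.2.3 (i)), with an involution counter-model.

With the companions: EACH of the ten typed clauses holds on some inhabitant of the interface and fails on
another, i.e. all ten are independent of `BadLocalFrobenioid l K_v` — hypotheses on the REAL construction
([EtTh] §5, [FrdII] Ex. 1.1), to be proved at merge (plan/L5/DISCHARGE-L5.md §E).
Nothing here concerns the objects of the text; typed ≠ proved; no side is taken on [IUTchIII] Cor. 3.12.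
-/

noncomputable section

namespace Literature.IUT.HodgeTheaters

open CategoryTheory

namespace DoublingWitness

/-- `⌈·/2⌉` on finite elements. [folklore] -/
@[simp] private theorem halfW_coe (n : ℤ) : halfW (n : W) = ((halfUp n : ℤ) : W) := rfl

/-- Doubling on finite elements (local copy of the private lemma of the companion file). [folklore] -/
private theorem dblW_coe' (n : ℤ) : dblW (n : W) = ((2 * n : ℤ) : W) := rfl

/-- The shift on finite elements (local copy of the private lemma of the companion file). [folklore] -/
private theorem shift_functor_obj_coe' (n : ℤ) : shift.functor.obj (n : W) = ((n + 1 : ℤ) : W) := rfl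

/-- `⌈0/2⌉ = 0`. [folklore] -/
private theorem halfUp_zero : halfUp 0 = 0 := by decide
/-- `⌈1/2⌉ = 1`. [folklore] -/
private theorem halfUp_one : halfUp 1 = 1 := by decide
/-- `⌈2n/2⌉ = n`. [folklore] -/
private theorem halfUp_two_mul (n : ℤ) : halfUp (2 * n) = n := by simp only [halfUp]; omega

/-- `⌈·/2⌉ ∘ (2·) = id` on `W`. [folklore] -/
private theorem halfW_dblW (x : W) : halfW (dblW x) = x := by
  induction x using WithTop.recTopCoe with
  | top => rfl
  | coe n => rw [dblW_coe', halfW_coe, halfUp_two_mul]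

/-- Identity into the slice over `⊤` (models `D^Θ_v ⊆ (D_v)_{Ÿ_v}` with `D^Θ_v = D_v`, `Ÿ_v := ⊤`).
[folklore] -/
def idOver : W ⥤ Over (⊤ : W) := (𝟭 W).toOver ⊤ (fun _ => homOfLE le_top) fun _ => Subsingleton.elim _ _

/-- `idOver` is full. [folklore] -/
instance idOver_full : idOver.Full where
  map_surjective {Y Z} g := ⟨homOfLE (show Y ≤ Z from g.left.le), Over.OverMorphism.ext (Subsingleton.elim _ _)⟩

/-- `idOver` is faithful (its source is thin). [folklore] -/
instance idOver_faithful : idOver.Faithful := inferInstance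

/-- **Descent obstruction**: the shift does not descend along `⌈·/2⌉` — there is no self-equivalence
`e'` of `W` with `half ⋙ e' ≅ shift ⋙ half` (evaluate at `0` and at `-1`: `e'(0)` would be both `1` and `0`).
[folklore] -/
private theorem not_exists_descend_shift :
    ¬ ∃ e' : W ≌ W, Nonempty (half ⋙ e'.functor ≅ shift.functor ⋙ half) := by
  rintro ⟨e', ⟨I⟩⟩
  have h0 := (I.app ((0 : ℤ) : W)).to_eq
  have h1 := (I.app ((-1 : ℤ) : W)).to_eq
  change e'.functor.obj (halfW ((0 : ℤ) : W)) = halfW (shift.functor.obj ((0 : ℤ) : W)) at h0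
  change e'.functor.obj (halfW ((-1 : ℤ) : W)) = halfW (shift.functor.obj ((-1 : ℤ) : W)) at h1
  rw [shift_functor_obj_coe', halfW_coe, halfW_coe] at h0 h1
  have e0 : halfUp 0 = 0 := by decide
  have e1 : halfUp (0 + 1) = 1 := by decide
  have e2 : halfUp (-1) = 0 := by decide
  have e3 : halfUp (-1 + 1) = 0 := by decide
  rw [e0, e1] at h0
  rw [e2, e3] at h1
  exact absurd (WithTop.coe_eq_coe.mp (h0.symm.trans h1)) (by decide)

end DoublingWitness

open DoublingWitness Witness

namespace BadLocalFrobenioid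

variable (l : ℕ) (Kv : Type) [Field Kv] [ValuativeRel Kv]

/-- **The halving inhabitant of `BadLocalFrobenioid l K_v`**: every carrier `W = ℤ ∪ {⊤}`; the inclusions
`D⊢_v ⊆ D_v`, `C_v ⊆ F̲_v`, `C⊢_v ⊆ C_v` identities; the structure functors `F̲_v → D_v`, `F̲_v → F÷_v`,
`C⊢_v → D⊢_v`, `C^Θ_v → D^Θ_v`, `C^Θ_v → F÷_v` the surjection `⌈·/2⌉`; `F÷_v → D_v` the identity; the
Frobenius-trivial object over `A` is `2A`; `Ÿ_v := ⊤`; `Θ̲_v = id`, `q_v = q̲_v = 1`, splittings `⊥`,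
monoids trivial. A toy serving only as a counter-model. [claim: Mochizuki2012, status: disputed] -/
def halving : BadLocalFrobenioid.{0} l Kv where
  Dv := W
  Ddash := W
  incl := 𝟭 W
  proj := 𝟭 W
  adj := Adjunction.id
  Fv := W
  toBase := half
  T := dblW
  T_base A := eqToIso (halfW_dblW A)
  Fbirat := W
  birat := half
  biratBase := 𝟭 W
  birat_base := ⟨NatIso.ofComponents (fun _ => Iso.refl _) (fun _ => Subsingleton.elim _ _)⟩
  Ydd := ⊤
  unitsTY := ⊥
  unitsTY_comm x hx y hy := by rw [Subgroup.mem_bot] at hx hy; rw [hx, hy]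
  theta := Iso.refl _
  theta_mem := Subgroup.mem_bot.mpr rfl
  lZ := ⊥
  Cv := W
  hull := 𝟭 W
  q := 1
  qroot := 1
  qroot_pow := one_pow _
  Cdash := W
  CdashBase := half
  CdashToC := 𝟭 W
  CdashToC_base := ⟨NatIso.ofComponents (fun _ => Iso.refl _) (fun _ => Subsingleton.elim _ _)⟩
  tauDashOf _ := botSplitting W
  DTheta := W
  DThetaIncl := idOver
  prodEquiv := CategoryTheory.Equivalence.refl
  OTheta := unitMon W
  OThetaUnits _ := ⊤
  OThetaUnits_isUnit _ x :=
    ⟨fun _ => @isUnit_of_subsingleton _ _ (inferInstanceAs (Subsingleton PUnit.{1})) x,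
      fun _ => Submonoid.mem_top _⟩
  OThetaOf _ := unitMon W
  OThetaOf_theta := rfl
  CTheta := W
  CThetaBase := half
  CThetaToBirat := half
  CThetaToBirat_base := ⟨NatIso.ofComponents (fun _ => Iso.refl _) (fun _ => Subsingleton.elim _ _)⟩
  tauThetaOf _ := botSplitting W
  dashThetaEquiv := CategoryTheory.Equivalence.refl
  dashThetaEquiv_tau _ := Submonoid.map_bot _
  dashThetaEquiv_base := ⟨NatIso.ofComponents (fun _ => Iso.refl _) (fun _ => Subsingleton.elim _ _)⟩

/-- Ex. 3.2 (ii) as typed, `BiratFromF` ("`F÷_v` may be reconstructed category-theoretically from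
`F̲_v`", [FrdI] Cor. 4.10), FAILS on the halving inhabitant: the shift of `F̲_v` does not descend along
`F̲_v → F÷_v = ⌈·/2⌉`. [claim: Mochizuki2012, status: disputed] -/
theorem halving_not_biratFromF : ¬ (halving l Kv).BiratFromF := fun h =>
  not_exists_descend_shift (h shift)

/-- Ex. 3.2 (ii) as typed, `ThetaFromF` ("`T_{Ÿ_v}` and `Θ̲_v` may be reconstructed
category-theoretically from `F̲_v`", [EtTh] Thm. 5.7), FAILS on the halving inhabitant (already its lift
`e'` of the shift to `F÷_v` cannot exist). [claim: Mochizuki2012, status: disputed] -/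
theorem halving_not_thetaFromF : ¬ (halving l Kv).ThetaFromF := fun h => by
  obtain ⟨e', η, -, -⟩ := h shift
  exact not_exists_descend_shift ⟨e', ⟨η⟩⟩

/-- Ex. 3.2 (vi) (d) as typed, `DFromF` ("`D_v` may be reconstructed category-theoretically from `F̲_v`
or from `C_v`", [EtTh] Thm. 4.4 / [FrdI] Thm. 3.4 (v)), FAILS on the halving inhabitant (first conjunct:
the shift of `F̲_v` does not descend along `F̲_v → D_v = ⌈·/2⌉`). [claim: Mochizuki2012, status: disputed] -/
theorem halving_not_dFromF : ¬ (halving l Kv).DFromF := fun h =>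
  not_exists_descend_shift (h.1 shift)

/-- Ex. 3.2 (vi) (c) as typed, `BasesFromC` ("`D⊢_v` (resp. `D^Θ_v`) may be reconstructed
category-theoretically from `C⊢_v` (resp. `C^Θ_v`)", [FrdI] Thm. 3.4 (v), [FrdII] Thm. 1.2 (i)), FAILS on
the halving inhabitant (first conjunct: the shift of `C⊢_v` does not descend along `C⊢_v → D⊢_v = ⌈·/2⌉`).
[claim: Mochizuki2012, status: disputed] -/
theorem halving_not_basesFromC : ¬ (halving l Kv).BasesFromC := fun h =>
  not_exists_descend_shift (h.1 shift)

/-- Ex. 3.2 (vi) (e) as typed, `FthetaFromF`, FAILS on the halving inhabitant too (first conjunct).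
[claim: Mochizuki2012, status: disputed] -/
theorem halving_not_fthetaFromF : ¬ (halving l Kv).FthetaFromF := fun h => by
  obtain ⟨e', -, ⟨I⟩, -⟩ := h shift
  exact not_exists_descend_shift ⟨e', ⟨I⟩⟩

/-- **Independence certificate, second part** (with `exists_not_ex32Reconstruction`): the interface
`BadLocalFrobenioid l K_v` has an inhabitant on which `BiratFromF`, `ThetaFromF` (Ex. 3.2 (ii)), `DFromF`
(vi)(d), `BasesFromC` (vi)(c) and `FthetaFromF` (vi)(e) all fail. [claim: Mochizuki2012, status: disputed] -/
theorem exists_not_ex32Reconstruction₂ :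
    ∃ B : BadLocalFrobenioid.{0} l Kv,
      ¬ B.BiratFromF ∧ ¬ B.ThetaFromF ∧ ¬ B.DFromF ∧ ¬ B.BasesFromC ∧ ¬ B.FthetaFromF :=
  ⟨halving l Kv, halving_not_biratFromF l Kv, halving_not_thetaFromF l Kv, halving_not_dFromF l Kv,
    halving_not_basesFromC l Kv, halving_not_fthetaFromF l Kv⟩

/-- In particular none of `BiratFromF`, `ThetaFromF`, `DFromF`, `BasesFromC` is a theorem about ALL
inhabitants of the interface. [claim: Mochizuki2012, status: disputed] -/
theorem not_forall_ex32Reconstruction₂ :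
    ¬ (∀ B : BadLocalFrobenioid.{0} l Kv, B.BiratFromF) ∧ ¬ (∀ B : BadLocalFrobenioid.{0} l Kv, B.ThetaFromF) ∧
    ¬ (∀ B : BadLocalFrobenioid.{0} l Kv, B.DFromF) ∧ ¬ (∀ B : BadLocalFrobenioid.{0} l Kv, B.BasesFromC) :=
  ⟨fun h => halving_not_biratFromF l Kv (h _), fun h => halving_not_thetaFromF l Kv (h _),
    fun h => halving_not_dFromF l Kv (h _), fun h => halving_not_basesFromC l Kv (h _)⟩

end BadLocalFrobenioid

end Literature.IUT.HodgeTheaters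

end
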